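import Summits.Langlands.Langlands.Statement
import Literature.NumberTheory.Automorphic.AlgebraicityTwist
import Literature.NumberTheory.Automorphic.AutomorphicTwistNorm
import Literature.NumberTheory.Automorphic.ArchParameterUnique
import Literature.NumberTheory.Automorphic.AutomorphicRepsGLSatakeFlathProofs
import HarnessLib

/-!
# Line `Sketch` for the crux `ReciprocityUpToIrreducibility` (item stmt-Langlands-14328), wave N13-S:
# the Satake half of weak existence W on the REGULAR sector in every rank, modulo lang.S27

Support file (closes nothing; stub `stub_satakeAE_of_regular_of_exists_galoisRep` of the registered
skeleton of line `Sketch`, continuation lead c9).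

Let `K` be totally real or CM, `n ≥ 1`, and `π` a cuspidal automorphic representation datum of
`GL_n(𝔸_K)` which is `L`-algebraic (Buzzard–Gee Def. 3.1.1) and has a REGULAR infinity type.
GRANTING the route's own node lang.S27 (`exists_galoisRep_of_regularAlgebraic`:
Harris–Lan–Taylor–Thorne 2016 Thm. A / Scholze / Varma — for a regular algebraic (Clozel) cuspidal
`π'` there is a semisimple `r : Γ_K → GL_n(ℚ̄_ℓ)` with `char(r(Frob_v)) = ∏ (X - ι⁻¹((q_v^{(n-1)/2} β_j)⁻¹))`
at every unramified `v ∤ ℓ` with Satake parameter `β`, i.e. the `C`-normalisation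
`arithFrobPolyOfSatake ι q_v n β`), for every prime `ℓ` and `ι : ℚ̄_ℓ ≃+* ℂ` there is a
`ρ : Γ_K → GL_n(ℚ̄_ℓ)` which is unramified almost everywhere and Satake–Frobenius compatible with `π`
almost everywhere in the summit's `L`-normalisation (`SatakeFrobCompatibleAt ι π ρ v`: a Satake
parameter `α` of `π` at `v`, `ρ` unramified at `v`, `char(ρ(Frob_v)) = ∏ (X - ι⁻¹(α_j⁻¹))`) — the open
stub `stub_weakExistence` (Buzzard–Gee Conj. 3.2.2, weak form) MINUS its de Rham clause, on the
regular sector.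

The whole content is Buzzard–Gee's half-twist bookkeeping `π ↦ πt = π ⊗ |det|^{(n-1)/2}` (§5.3):

* two infinity types of `π` have the same multisets of `z`-exponents
  (`AutomorphicRepData.HasInfinityType.map_a_eq`), so the `L`-algebraic type of `π` is regular too;
* `πt = π ⊗ |det|_𝔸^{(n-1)/2}` is a cuspidal datum with infinity type `T.twist ((n-1)/2)`
  (`CuspidalAutomorphicRepData.exists_twist_hasInfinityType`, Borel–Jacquet 5.7), which is
  `C`-algebraic (`InfinityType.isCAlgebraic_iff_isLAlgebraic_twist`: `T.twist (n-1)` is `L`-algebraic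
  with `T`, `isLAlgebraic_twist_intCast_iff`) and regular (`IsRegular.twist`): `πt` is regular
  algebraic in the sense of Clozel, and lang.S27 applies to it;
* the Satake parameters of `πt` are `q_v^{-(n-1)/2} α` for those of `π`
  (`AutomorphicRepData.HasSatakeParamAt.of_map_mulChar_detTwist_of_cpow`, Arthur–Clozel Ch. 3), and
  `(√q_v)^{n-1} · q_v^{-(n-1)/2} α_j = α_j`, so
  `arithFrobPolyOfSatake ι q_v n (q_v^{-(n-1)/2} α) = arithFrobPolyOfSatake ι q_v 1 α`
  (`arithFrobPolyOfSatake_map_cpow_neg_half_mul`);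
* `π` is unramified at almost every place (`hasSatakeParamAt_cofinite_holds`, Flath) and only
  finitely many places lie above `ℓ` (`Ideal.finite_factors`).

The `n = 2`, totally real case (with Ribet's irreducibility on top) is the tree's
`exists_irreducible_satakeFrobCompatibleAE_GL2` (`WachComponentCensusLiftB2UnramSplitPInPrint`), whose
proof is followed here verbatim in rank `n`.

References: M. Harris, K.-W. Lan, R. Taylor, J. Thorne, Res. Math. Sci. 3 (2016), Thm. A
[HarrisLanTaylorThorneRMS2016]; K. Buzzard, T. Gee, LMS LNS 414 (2014), Def. 3.1.1, Conj. 3.2.1–3.2.2,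
§5.3 [BuzzardGeeLMS2014]; L. Clozel, *Motifs et formes automorphes* (1990), Déf. 1.8, 3.12 [Clozel1990];
I. Varma, Forum Math. Sigma 12 (2024), Thm. 1 [VarmaFMS2024].

No definitions; standard axioms only; the named fact lang.S27 enters as the HYPOTHESIS
`exists_galoisRep_of_regularAlgebraic` of every theorem (it is not assumed as an axiom).
-/

noncomputable section

set_option linter.dupNamespace false -- project-wide option (lakefile weak.linter.dupNamespace); `Summit.Langlands.Langlands` is the mandated namespace

open scoped NumberField Classical Polynomial
open Filter IsDedekindDomain Polynomial
open Literature.NumberTheory.Automorphic Literature.NumberTheory.GaloisRepresentations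
open Summit.Langlands

namespace Summit.Langlands.Langlands.Theorems.ReciprocityUpToIrreducibility

/-! ### The half-twist on the predicted Frobenius polynomial -/

/-- **`(√q)^{n-1} = q^{(n-1)/2}` in `ℂ`** (real exponent `((n:ℝ)-1)/2`, `n ≥ 1`): the scalar by which
Buzzard–Gee's `C`- and `L`-normalisations of the Frobenius polynomial differ.
[cite: BuzzardGeeLMS2014, Conj. 3.2.2 and §5.3] -/
theorem ofReal_sqrt_pow_pred_eq_cpow (q : ℕ) {n : ℕ} (hn : 0 < n) :
    ((Real.sqrt q : ℝ) : ℂ) ^ (n - 1) = (q : ℂ) ^ ((((n : ℝ) - 1) / 2 : ℝ) : ℂ) := by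
  have hq : (0 : ℝ) ≤ (q : ℝ) := Nat.cast_nonneg q
  have hreal : (Real.sqrt q : ℝ) ^ (n - 1) = (q : ℝ) ^ (((n : ℝ) - 1) / 2 : ℝ) := by
    rw [Real.sqrt_eq_rpow, ← Real.rpow_natCast, ← Real.rpow_mul hq, Nat.cast_sub hn]
    push_cast
    ring_nf
  rw [← Complex.ofReal_pow, hreal, Complex.ofReal_cpow hq]
  push_cast
  rfl

/-- **Undoing the half-twist on the predicted Frobenius polynomial** (Buzzard–Gee §5.3): for
`n ≥ 1`, `q ≥ 1` and any multiset `α`,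
`arithFrobPolyOfSatake ι q n (q^{-(n-1)/2} · α) = arithFrobPolyOfSatake ι q 1 α`, since
`(√q)^{n-1} · (q^{-(n-1)/2} a) = a`: the `C`-normalised Frobenius polynomial of the Satake parameter
of `π ⊗ |det|^{(n-1)/2}` is the `L`-normalised Frobenius polynomial of the Satake parameter of `π`.
[cite: BuzzardGeeLMS2014, Conj. 3.2.2 and §5.3] [cite: HarrisLanTaylorThorneRMS2016, Thm. A] -/
theorem arithFrobPolyOfSatake_map_cpow_neg_half_mul {ℓ : ℕ} [Fact ℓ.Prime] (ι : PadicAlgCl ℓ ≃+* ℂ)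
    {q : ℕ} (hq : (q : ℂ) ≠ 0) {n : ℕ} (hn : 0 < n) (α : Multiset ℂ) :
    arithFrobPolyOfSatake ι q n (α.map (((q : ℂ) ^ (-((((n : ℝ) - 1) / 2 : ℝ) : ℂ))) * ·)) =
      arithFrobPolyOfSatake ι q 1 α := by
  unfold arithFrobPolyOfSatake
  rw [Multiset.map_map]
  congr 1
  refine Multiset.map_congr rfl fun a _ => ?_
  simp only [Function.comp_apply]
  congr 3
  rw [ofReal_sqrt_pow_pred_eq_cpow q hn, show (1 - 1 : ℕ) = 0 from rfl, pow_zero, one_mul,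
    ← mul_assoc, ← Complex.cpow_add _ _ hq, add_neg_cancel, Complex.cpow_zero, one_mul]

/-! ### The regular algebraic twist and lang.S27 -/

variable {K : Type} [Field K] [NumberField K] {n : ℕ} {hcpt : isCompact_glFiniteIntegralLevel n K}

/-- **An `L`-algebraic cuspidal `π` with a regular infinity type has a REGULAR ALGEBRAIC (Clozel)
cuspidal twist `πt = π ⊗ |det|_𝔸^{(n-1)/2}`** (`n ≥ 1`): a cuspidal datum `πt` with
`πt.W = |det|^{(n-1)/2} · π.W`, `πt.W' = |det|^{(n-1)/2} · π.W'` for a Hecke character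
`χ = ‖·‖^{(n-1)/2}`, which is regular algebraic.  The `L`-algebraic infinity type `T'` of `π` is
regular because its `z`-exponents are those of the given regular type (`HasInfinityType.map_a_eq`);
`T'.twist ((n-1)/2)` is `C`-algebraic (`isCAlgebraic_iff_isLAlgebraic_twist`,
`isLAlgebraic_twist_intCast_iff` with the integer `n - 1`) and regular (`IsRegular.twist`).
[cite: BuzzardGeeLMS2014, Conj. 3.2.2 and §5.3] [cite: Clozel1990, Déf. 1.8, 3.12] -/
theorem exists_twist_isRegularAlgebraic_of_isLAlgebraic_of_isRegular [NeZero n]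
    (π : CuspidalAutomorphicRepData n K hcpt) (hL : π.1.IsLAlgebraic)
    (hreg : ∃ T : InfinityType K n, π.1.HasInfinityType T ∧ T.IsRegular) :
    ∃ (χ : HeckeCharacter K) (πt : CuspidalAutomorphicRepData n K hcpt),
      (∀ x : ideleGroup K,
        ((χ x : ℂˣ) : ℂ) = (ideleNorm x : ℂ) ^ ((((n : ℝ) - 1) / 2 : ℝ) : ℂ)) ∧
      πt.1.W = π.1.W.map (mulChar (detTwist n χ)) ∧ πt.1.W' = π.1.W'.map (mulChar (detTwist n χ)) ∧
      πt.1.IsRegularAlgebraic := by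
  obtain ⟨T', hT', hT'L⟩ := hL
  obtain ⟨T, hT, hTreg⟩ := hreg
  -- the `a`-multisets of two infinity types of `π` agree, so `T'` is regular as well
  have hT'reg : T'.IsRegular := fun σ => by
    rw [← AutomorphicRepData.HasInfinityType.map_a_eq π.1 hT hT' σ]
    exact hTreg σ
  obtain ⟨χ, πt, hχ, hW, hW', hπtT⟩ := π.exists_twist_hasInfinityType (((n : ℝ) - 1) / 2) hT'
  refine ⟨χ, πt, hχ, hW, hW', T'.twist _, hπtT, ?_, hT'reg.twist _⟩
  rw [InfinityType.isCAlgebraic_iff_isLAlgebraic_twist, InfinityType.twist_twist]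
  convert (InfinityType.isLAlgebraic_twist_intCast_iff T' ((n : ℤ) - 1)).mpr hT'L using 2
  push_cast
  ring

/-- **Galois representations of `L`-algebraic regular cuspidal `π` on `GL_n` over a totally real or
CM field, in Buzzard–Gee's `L`-normalisation, POINTWISE at the good places — from lang.S27.**
Granting `exists_galoisRep_of_regularAlgebraic` (Harris–Lan–Taylor–Thorne Thm. A, Scholze, Varma),
for `π` cuspidal `L`-algebraic with a regular infinity type (`n ≥ 1`) and `ι : ℚ̄_ℓ ≃+* ℂ` there is a
semisimple continuous `r : Γ_K → GL_n(ℚ̄_ℓ)` such that at EVERY finite place `v ∤ ℓ` at which `π`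
has Satake parameter `α`, `r` is unramified and `char(r(Frob_v)) = ∏_j (X - ι⁻¹(α_j⁻¹))`
(`arithFrobPolyOfSatake ι q_v 1 α`): apply lang.S27 to the regular algebraic twist
`πt = π ⊗ |det|^{(n-1)/2}` (`exists_twist_isRegularAlgebraic_of_isLAlgebraic_of_isRegular`), whose
Satake parameter at `v` is `q_v^{-(n-1)/2} α` (`HasSatakeParamAt.of_map_mulChar_detTwist_of_cpow`),
and undo the shift (`arithFrobPolyOfSatake_map_cpow_neg_half_mul`).
[cite: HarrisLanTaylorThorneRMS2016, Thm. A] [cite: BuzzardGeeLMS2014, Conj. 3.2.2 and §5.3] -/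
theorem exists_galoisRep_of_isLAlgebraic_of_isRegular (h27 : exists_galoisRep_of_regularAlgebraic)
    (hcpt : isCompact_glFiniteIntegralLevel n K) (hn : 0 < n)
    (hK : NumberField.IsTotallyReal K ∨ NumberField.IsCMField K)
    (π : CuspidalAutomorphicRepData n K hcpt) (hL : π.1.IsLAlgebraic)
    (hreg : ∃ T : InfinityType K n, π.1.HasInfinityType T ∧ T.IsRegular)
    (ℓ : ℕ) [Fact ℓ.Prime] (ι : PadicAlgCl ℓ ≃+* ℂ) :
    ∃ r : FramedGaloisRep K (PadicAlgCl ℓ) n, r.toGaloisRep.IsSemisimple ∧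
      ∀ (v : HeightOneSpectrum (𝓞 K)) (α : Multiset ℂ), π.1.HasSatakeParamAt v α →
        ((ℓ : ℕ) : 𝓞 K) ∉ v.asIdeal →
          r.IsUnramifiedAt v ∧ r.HasFrobCharpolyAt v (arithFrobPolyOfSatake ι v.residueCard 1 α) := by
  haveI : NeZero n := ⟨hn.ne'⟩
  obtain ⟨χ, πt, hχ, hW, hW', hπtalg⟩ :=
    exists_twist_isRegularAlgebraic_of_isLAlgebraic_of_isRegular π hL hreg
  obtain ⟨r, hrss, hr⟩ := h27 hcpt hK πt hπtalg ℓ ι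
  refine ⟨r, hrss, fun v α hα hvℓ => ?_⟩
  have hq : (v.residueCard : ℂ) ≠ 0 :=
    Nat.cast_ne_zero.mpr (lt_trans zero_lt_one v.one_lt_residueCard).ne'
  have hπtα := AutomorphicRepData.HasSatakeParamAt.of_map_mulChar_detTwist_of_cpow hχ hW hW' hα
  obtain ⟨hur, hcp⟩ := hr v _ hπtα hvℓ
  refine ⟨hur, ?_⟩
  rw [← arithFrobPolyOfSatake_map_cpow_neg_half_mul ι hq hn α]
  exact hcp

/-! ### The Satake half of W on the regular sector -/

/-- **The Satake half of Buzzard–Gee's weak existence W on the regular sector, every rank, modulo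
lang.S27.**  Granting `exists_galoisRep_of_regularAlgebraic`, every `L`-algebraic cuspidal `π` of
`GL_n(𝔸_K)` (`n ≥ 1`, `K` totally real or CM) with a regular infinity type has, for all `ℓ` and
`ι : ℚ̄_ℓ ≃+* ℂ`, some `ρ : Γ_K → GL_n(ℚ̄_ℓ)` unramified at almost every place and Satake–Frobenius
compatible with `π` (`SatakeFrobCompatibleAt ι π ρ v`) at almost every place: the pointwise
statement `exists_galoisRep_of_isLAlgebraic_of_isRegular` at the cofinitely many places where `π` is
unramified (`hasSatakeParamAt_cofinite_holds`) and which do not lie above `ℓ` (`Ideal.finite_factors`).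
[cite: HarrisLanTaylorThorneRMS2016, Thm. A] [cite: BuzzardGeeLMS2014, Conj. 3.2.2 and §5.3] -/
theorem satakeAE_of_regular_of_exists_galoisRep (h27 : exists_galoisRep_of_regularAlgebraic)
    (hcpt : isCompact_glFiniteIntegralLevel n K) (hn : 0 < n)
    (hK : NumberField.IsTotallyReal K ∨ NumberField.IsCMField K)
    (π : CuspidalAutomorphicRepData n K hcpt) (hL : π.1.IsLAlgebraic)
    (hreg : ∃ T : InfinityType K n, π.1.HasInfinityType T ∧ T.IsRegular)
    (ℓ : ℕ) [Fact ℓ.Prime] (ι : PadicAlgCl ℓ ≃+* ℂ) :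
    ∃ ρ : FramedGaloisRep K (PadicAlgCl ℓ) n,
      (∀ᶠ v : HeightOneSpectrum (𝓞 K) in cofinite, ρ.IsUnramifiedAt v) ∧
      ∀ᶠ v : HeightOneSpectrum (𝓞 K) in cofinite, SatakeFrobCompatibleAt ι π.1 ρ v := by
  obtain ⟨r, -, hr⟩ := exists_galoisRep_of_isLAlgebraic_of_isRegular h27 hcpt hn hK π hL hreg ℓ ι
  -- the finitely many places above `ℓ`
  have hℓ0 : Ideal.span {((ℓ : ℕ) : 𝓞 K)} ≠ ⊥ := by
    rw [Ne, Ideal.span_singleton_eq_bot]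
    exact_mod_cast (Fact.out : ℓ.Prime).ne_zero
  have hfin : ∀ᶠ v : HeightOneSpectrum (𝓞 K) in cofinite, ((ℓ : ℕ) : 𝓞 K) ∉ v.asIdeal := by
    rw [Filter.eventually_cofinite]
    refine (Ideal.finite_factors hℓ0).subset fun v hv => ?_
    simp only [Set.mem_setOf_eq, not_not] at hv
    exact Ideal.dvd_span_singleton.mpr hv
  -- `π` is unramified at almost every place (Flath)
  have hunr : ∀ᶠ v : HeightOneSpectrum (𝓞 K) in cofinite, π.1.IsUnramifiedAt v :=
    π.1.hasSatakeParamAt_cofinite_holds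
  have key : ∀ᶠ v : HeightOneSpectrum (𝓞 K) in cofinite, SatakeFrobCompatibleAt ι π.1 r v := by
    filter_upwards [hunr, hfin] with v hv hvℓ
    obtain ⟨α, hα⟩ := hv
    exact ⟨α, hα, hr v α hα hvℓ⟩
  exact ⟨r, key.mono fun v ⟨_, _, h, _⟩ => h, key⟩

/-- **stub N13-S (the Satake half of W on the regular sector, every rank, modulo lang.S27)** — closed
form of `satakeAE_of_regular_of_exists_galoisRep` (all binders explicit, in the order
`K, n, hcpt, 0 < n, K totally real ∨ CM, π, …, ℓ, ι`): the shape in which this sector is registered as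
a stub of the crux (`stub_satakeAE_of_regular_of_exists_galoisRep`, wave N13-S).
[cite: HarrisLanTaylorThorneRMS2016, Thm. A] [cite: BuzzardGeeLMS2014, Conj. 3.2.2 and §5.3]
[cite: Clozel1990, Déf. 1.8, 3.12] -/
theorem stub_satakeAE_of_regular_of_exists_galoisRep :
    exists_galoisRep_of_regularAlgebraic →
    ∀ (K : Type) [Field K] [NumberField K] (n : ℕ) (hcpt : isCompact_glFiniteIntegralLevel n K),
      0 < n → (NumberField.IsTotallyReal K ∨ NumberField.IsCMField K) →
      ∀ π : CuspidalAutomorphicRepData n K hcpt, π.1.IsLAlgebraic →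
      (∃ T : InfinityType K n, π.1.HasInfinityType T ∧ T.IsRegular) →
      ∀ (ℓ : ℕ) [Fact ℓ.Prime] (ι : PadicAlgCl ℓ ≃+* ℂ),
        ∃ ρ : FramedGaloisRep K (PadicAlgCl ℓ) n,
          (∀ᶠ v : HeightOneSpectrum (𝓞 K) in cofinite, ρ.IsUnramifiedAt v) ∧
          ∀ᶠ v : HeightOneSpectrum (𝓞 K) in cofinite, SatakeFrobCompatibleAt ι π.1 ρ v := by
  intro h27 K _ _ n hcpt hn hK π hL hreg ℓ _ ι
  exact satakeAE_of_regular_of_exists_galoisRep h27 hcpt hn hK π hL hreg ℓ ι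

end Summit.Langlands.Langlands.Theorems.ReciprocityUpToIrreducibility

end
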